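import Literature.Probability.Entropy.JensenShannonPinsker
import HarnessLib

/-!
# Law-level Shannon calculus on finite types: mixtures, chain rule along a map, subadditivity, mutual information as expected divergence, conditional data processing

[cite: PolyanskiyWu2024, Thm 1.4 (d),(e),(g); Thm 3.2 (a),(d); Thm 3.4 (c); Thm 7.10].  Everything is
stated for LAWS given as nonnegative functions on finite types (`H(ν) := Σ negMulLog (ν ·)`, natural
logarithm, no normalisation unless stated), so that an "entropy budget" argument over a deterministic
process driven by uniform bits can be run by finite sums alone (companion of
`JensenShannonPinsker.lean`; the random-variable versions are the tree's `FiniteShannon.lean` and the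
PFR port).

**Content (all PROVED; no named facts).**
* `sum_mul_sum_negMulLog_le` — concavity of `H` under finite mixtures:
  `Σ_b w_b H(P_b) ≤ H(Σ_b w_b P_b)` (Jensen for `negMulLog`) [Thm 1.4 (d)];
* `sum_negMulLog_eq_fiber_chain` — chain rule along a map `f : W → X`:
  `H(ν) = H(f_*ν) + Σ_x (f_*ν)(x) · H(ν|_{f = x} / (f_*ν)(x))` for any `ν ≥ 0` [Thm 1.4 (e),(g)];
* `sum_negMulLog_joint_eq_chain`, `sum_negMulLog_joint_le` — the coordinate case: for a joint law `J`
  on `X × B` with marginals `P`, `β`: `H(J) = H(β) + Σ_b β_b H(J(·,b)/β_b)` and SUBADDITIVITY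
  `H(J) ≤ H(P) + H(β)` [Thm 1.4 (e)];
* `two_mul_tvDist_sq_le_kl_of_ac` — Pinsker under absolute continuity (`Q ≥ 0`, `P = 0` where
  `Q = 0`) [Thm 7.10]; `sum_mul_log_cond_eq` — `Σ_{x,b} J log (J/(β P)) = H(P) + H(β) − H(J)`
  (`I(X;B)` as expected divergence) [Thm 3.2 (a), Thm 3.4 (c)]; `two_mul_mul_tvDist_cond_sq_le` — for
  every `b` with `β_b > 0`: `2 β_b · TV(J(·,b)/β_b, P)² ≤ H(P) + H(β) − H(J)`;
* `sum_negMulLog_loss_concave` — the entropy LOSS `H(ν) − H(f_*ν)` is concave under mixtures, and its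
  consequence `condEntropy_dataProcessing`: for `R` on `W × B` and `f : W → X`, with
  `J := (f × id)_* R`: `H(R) − H(R_W) ≤ H(J) − H(J_X)`, i.e. `H(B | W) ≤ H(B | f(W))`, i.e.
  `I(B; f(W)) ≤ I(B; W)` [Thm 3.2 (d)].
-/

namespace Literature.Probability.Entropy

open Finset Real
open Literature.Probability.MarkovChains

variable {X : Type*} [Fintype X] [DecidableEq X]

/-! ### 1. Concavity of `H` under finite mixtures -/

omit [Fintype X] [DecidableEq X] in
/-- **Concavity of entropy under mixtures** (on any finite set of points `s`): for weights `w ≥ 0`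
with `Σ w = 1` and nonnegative `P_b`, `Σ_b w_b Σ_{x∈s} φ(P_b x) ≤ Σ_{x∈s} φ(Σ_b w_b P_b x)`,
`φ = negMulLog`. [cite: PolyanskiyWu2024, Thm 1.4 (d)] -/
theorem sum_mul_sum_negMulLog_le {B : Type*} [Fintype B] (s : Finset X) (w : B → ℝ)
    (hw : ∀ b, 0 ≤ w b) (hw1 : ∑ b, w b = 1) (P : B → X → ℝ) (hP : ∀ b x, 0 ≤ P b x) :
    ∑ b, w b * ∑ x ∈ s, negMulLog (P b x) ≤ ∑ x ∈ s, negMulLog (∑ b, w b * P b x) := by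
  calc ∑ b, w b * ∑ x ∈ s, negMulLog (P b x) = ∑ x ∈ s, ∑ b, w b * negMulLog (P b x) := by
        simp_rw [mul_sum]; rw [sum_comm]
    _ ≤ ∑ x ∈ s, negMulLog (∑ b, w b * P b x) := sum_le_sum fun x _ => by
        have h := ConcaveOn.le_map_sum concaveOn_negMulLog (t := univ) (w := w) (p := fun b => P b x)
          (fun b _ => hw b) hw1 (fun b _ => Set.mem_Ici.mpr (hP b x))
        simpa only [smul_eq_mul] using h

/-! ### 2. Chain rule along a map -/

/-- Per-fibre computation: for nonnegative `ν` on a finite set `s` with mass `m = Σ_s ν`,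
`Σ_{s} φ(ν w) = φ(m) + m · Σ_{s} φ(ν w / m)`. [cite: PolyanskiyWu2024, Thm 1.4 (e)] -/
theorem sum_negMulLog_eq_of_mass {W : Type*} (s : Finset W) {ν : W → ℝ} (hν : ∀ w ∈ s, 0 ≤ ν w) :
    ∑ w ∈ s, negMulLog (ν w)
      = negMulLog (∑ w ∈ s, ν w) + (∑ w ∈ s, ν w) * ∑ w ∈ s, negMulLog (ν w / ∑ w' ∈ s, ν w') := by
  set m := ∑ w ∈ s, ν w with hm
  by_cases hm0 : m = 0
  · have hz : ∀ w ∈ s, ν w = 0 := (sum_eq_zero_iff_of_nonneg hν).mp hm0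
    rw [hm0, negMulLog_zero, zero_mul, add_zero]
    exact sum_eq_zero fun w hw => by rw [hz w hw, negMulLog_zero]
  · have hkey : ∀ w ∈ s, negMulLog (ν w) = (ν w / m) * negMulLog m + m * negMulLog (ν w / m) := by
      intro w _
      rw [← negMulLog_mul, mul_div_cancel₀ _ hm0]
    rw [sum_congr rfl hkey, sum_add_distrib, ← sum_mul, ← sum_div, div_self hm0, one_mul, ← mul_sum]

/-- **Chain rule along a map** `f : W → X` for any `ν ≥ 0`:
`H(ν) = H(f_*ν) + Σ_x (f_*ν)(x) · H(ν restricted to the fibre of x, normalised)`.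
[cite: PolyanskiyWu2024, Thm 1.4 (g) (H(X,Y) = H(X) + H(Y|X) with X = f(W), Y = W)] -/
theorem sum_negMulLog_eq_fiber_chain {W : Type*} [Fintype W] (f : W → X) {ν : W → ℝ}
    (hν : ∀ w, 0 ≤ ν w) :
    ∑ w, negMulLog (ν w)
      = ∑ x, negMulLog (∑ w ∈ univ.filter (fun w => f w = x), ν w)
        + ∑ x, (∑ w ∈ univ.filter (fun w => f w = x), ν w) *
            ∑ w ∈ univ.filter (fun w => f w = x),
              negMulLog (ν w / ∑ w' ∈ univ.filter (fun w' => f w' = x), ν w') := by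
  rw [← sum_add_distrib, ← Finset.sum_fiberwise_of_maps_to (g := f) (s := univ) (t := univ)
    (fun w _ => mem_univ (f w)) (fun w => negMulLog (ν w))]
  exact sum_congr rfl fun x _ => sum_negMulLog_eq_of_mass _ fun w _ => hν w

/-! ### 3. Joint laws on `X × B`: chain rule and subadditivity -/

section Joint

variable {B : Type*} [Fintype B] [DecidableEq B]

omit [DecidableEq X] [DecidableEq B] in
/-- **Chain rule for a joint law** (conditioning on the second coordinate):
`H(J) = H(β) + Σ_b β_b · H(J(·, b)/β_b)`, `β_b = Σ_x J(x, b)`, for any `J ≥ 0`.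
[cite: PolyanskiyWu2024, Thm 1.4 (e)] -/
theorem sum_negMulLog_joint_eq_chain {J : X × B → ℝ} (hJ : ∀ z, 0 ≤ J z) :
    ∑ z, negMulLog (J z)
      = ∑ b, negMulLog (∑ x, J (x, b))
        + ∑ b, (∑ x, J (x, b)) * ∑ x, negMulLog (J (x, b) / ∑ x', J (x', b)) := by
  rw [Fintype.sum_prod_type_right, ← sum_add_distrib]
  exact sum_congr rfl fun b _ => sum_negMulLog_eq_of_mass univ fun x _ => hJ (x, b)

omit [DecidableEq X] [DecidableEq B] in
/-- The first marginal is the `β`-mixture of the conditional laws: `Σ_b β_b · (J(x,b)/β_b) = Σ_b J(x,b)`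
(terms with `β_b = 0` vanish on both sides). [folklore] -/
private theorem sum_mass_mul_cond_eq {J : X × B → ℝ} (hJ : ∀ z, 0 ≤ J z) (x : X) :
    ∑ b, (∑ x', J (x', b)) * (J (x, b) / ∑ x', J (x', b)) = ∑ b, J (x, b) := by
  refine sum_congr rfl fun b _ => ?_
  by_cases h0 : ∑ x', J (x', b) = 0
  · have : J (x, b) = 0 :=
      (sum_eq_zero_iff_of_nonneg (fun x' _ => hJ (x', b))).mp h0 x (mem_univ x)
    rw [h0, this]; simp
  · exact mul_div_cancel₀ _ h0

omit [DecidableEq X] [DecidableEq B] in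
/-- **Subadditivity** `H(J) ≤ H(P) + H(β)` for a joint law `J ≥ 0`, `Σ J = 1`, with marginals
`P x = Σ_b J(x,b)`, `β b = Σ_x J(x,b)` (chain rule + concavity of `H`: `H(X|B) ≤ H(X)`).
[cite: PolyanskiyWu2024, Thm 1.4 (d),(e)] -/
theorem sum_negMulLog_joint_le {J : X × B → ℝ} (hJ : ∀ z, 0 ≤ J z) (hJ1 : ∑ z, J z = 1) :
    ∑ z, negMulLog (J z)
      ≤ (∑ x, negMulLog (∑ b, J (x, b))) + ∑ b, negMulLog (∑ x, J (x, b)) := by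
  rw [sum_negMulLog_joint_eq_chain hJ, add_comm]
  have hβ1 : ∑ b, ∑ x, J (x, b) = 1 := by rw [← Fintype.sum_prod_type_right]; exact hJ1
  have hmix := sum_mul_sum_negMulLog_le (X := X) univ (fun b => ∑ x, J (x, b))
    (fun b => sum_nonneg fun x _ => hJ (x, b)) hβ1 (fun b x => J (x, b) / ∑ x', J (x', b))
    (fun b x => div_nonneg (hJ (x, b)) (sum_nonneg fun x' _ => hJ (x', b)))
  simp_rw [sum_mass_mul_cond_eq hJ] at hmix
  linarith

end Joint

/-! ### 4. Pinsker under absolute continuity; mutual information as expected divergence -/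

omit [DecidableEq X] in
/-- Sums of functions vanishing off a predicate may be taken over the subtype. [folklore] -/
private theorem sum_subtype_of_vanish' {f : X → ℝ} {p : X → Prop} [DecidablePred p]
    (hf : ∀ x, ¬ p x → f x = 0) : ∑ y : {x // p x}, f y = ∑ x, f x := by
  rw [← Finset.sum_subtype (univ.filter p) (by simp) f]
  exact sum_filter_of_ne fun x _ hx => by by_contra h; exact hx (hf x h)

/-- **Pinsker's inequality under absolute continuity**: `P, Q ≥ 0` summing to `1`, `P = 0`
wherever `Q = 0`: `2·TV(P,Q)² ≤ Σ_x P x log (P x / Q x)`. [cite: PolyanskiyWu2024, Thm 7.10] -/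
theorem two_mul_tvDist_sq_le_kl_of_ac {P Q : X → ℝ} (hP : ∀ x, 0 ≤ P x) (hQ : ∀ x, 0 ≤ Q x)
    (hac : ∀ x, Q x = 0 → P x = 0) (hP1 : ∑ x, P x = 1) (hQ1 : ∑ x, Q x = 1) :
    2 * tvDist P Q ^ 2 ≤ ∑ x, P x * Real.log (P x / Q x) := by
  let p : X → Prop := fun x => 0 < Q x
  have hoff : ∀ x, ¬ p x → Q x = 0 ∧ P x = 0 := by
    intro x hx
    have hq : Q x = 0 := le_antisymm (not_lt.mp hx) (hQ x)
    exact ⟨hq, hac x hq⟩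
  let Y := {x // p x}
  have hPY : ∑ y : Y, P y = 1 := by
    rw [sum_subtype_of_vanish' (f := P) fun x hx => (hoff x hx).2, hP1]
  have hQY : ∑ y : Y, Q y = 1 := by
    rw [sum_subtype_of_vanish' (f := Q) fun x hx => (hoff x hx).1, hQ1]
  have h := two_mul_tvDist_sq_le_kl_of_nonneg (P := fun y : Y => P y) (Q := fun y : Y => Q y)
    (fun y => hP y) (fun y => y.2) hPY hQY
  have htv : tvDist (fun y : Y => P y) (fun y : Y => Q y) = tvDist P Q := by
    simp only [tvDist]
    congr 1
    exact sum_subtype_of_vanish' (f := fun x => |P x - Q x|) fun x hx => by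
      rw [(hoff x hx).1, (hoff x hx).2]; simp
  have hkl : ∑ y : Y, P y * Real.log (P y / Q y) = ∑ x, P x * Real.log (P x / Q x) :=
    sum_subtype_of_vanish' (f := fun x => P x * Real.log (P x / Q x)) fun x hx => by
      rw [(hoff x hx).2, zero_mul]
  rwa [htv, hkl] at h

section MutualInfo

variable {B : Type*} [Fintype B] [DecidableEq B]

/-- Pointwise: `J log (J/(β P)) = J log J − J log β − J log P` when `J = 0 ∨ (β ≠ 0 ∧ P ≠ 0)`.
[folklore] -/
private theorem mul_log_div_mul_eq {j β P : ℝ} (h : j = 0 ∨ (β ≠ 0 ∧ P ≠ 0)) :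
    j * Real.log (j / (β * P)) = j * Real.log j - j * Real.log β - j * Real.log P := by
  rcases h with hj | ⟨hβ, hP⟩
  · simp [hj]
  · by_cases hj : j = 0
    · simp [hj]
    · rw [Real.log_div hj (mul_ne_zero hβ hP), Real.log_mul hβ hP]; ring

omit [DecidableEq X] [DecidableEq B] in
/-- **Mutual information as expected divergence**: for a joint law `J ≥ 0` with marginals `P`, `β`,
`Σ_b Σ_x J(x,b) log (J(x,b)/(β_b P_x)) = H(P) + H(β) − H(J)` (`I(X;B) = Σ_b β_b D(P_{X|B=b} ‖ P_X)`
and `I(X;B) = H(X) + H(B) − H(X,B)`). [cite: PolyanskiyWu2024, Thm 3.2 (a) and Thm 3.4 (c)] -/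
theorem sum_mul_log_cond_eq {J : X × B → ℝ} (hJ : ∀ z, 0 ≤ J z) :
    ∑ b, ∑ x, J (x, b) * Real.log (J (x, b) / ((∑ x', J (x', b)) * ∑ b', J (x, b')))
      = (∑ x, negMulLog (∑ b, J (x, b))) + (∑ b, negMulLog (∑ x, J (x, b)))
          - ∑ z, negMulLog (J z) := by
  -- pointwise splitting of the logarithm
  have hpt : ∀ b x, J (x, b) * Real.log (J (x, b) / ((∑ x', J (x', b)) * ∑ b', J (x, b')))
      = J (x, b) * Real.log (J (x, b)) - J (x, b) * Real.log (∑ x', J (x', b))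
          - J (x, b) * Real.log (∑ b', J (x, b')) := by
    intro b x
    apply mul_log_div_mul_eq
    by_cases hj : J (x, b) = 0
    · exact Or.inl hj
    · right
      have hjpos : 0 < J (x, b) := lt_of_le_of_ne (hJ (x, b)) (Ne.symm hj)
      constructor
      · exact ne_of_gt (lt_of_lt_of_le hjpos (single_le_sum (fun x' _ => hJ (x', b)) (mem_univ x)))
      · exact ne_of_gt (lt_of_lt_of_le hjpos
          (single_le_sum (f := fun b' => J (x, b')) (fun b' _ => hJ (x, b')) (mem_univ b)))
  simp_rw [hpt, sum_sub_distrib]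
  -- the three sums
  have h1 : ∑ b, ∑ x, J (x, b) * Real.log (J (x, b)) = -∑ z, negMulLog (J z) := by
    rw [Fintype.sum_prod_type_right, ← sum_neg_distrib]
    refine sum_congr rfl fun b _ => ?_
    rw [← sum_neg_distrib]
    refine sum_congr rfl fun x _ => ?_
    simp [negMulLog]
  have h2 : ∑ b, ∑ x, J (x, b) * Real.log (∑ x', J (x', b)) = -∑ b, negMulLog (∑ x, J (x, b)) := by
    rw [← sum_neg_distrib]
    refine sum_congr rfl fun b _ => ?_
    rw [← sum_mul]; simp [negMulLog]
  have h3 : ∑ b, ∑ x, J (x, b) * Real.log (∑ b', J (x, b')) = -∑ x, negMulLog (∑ b, J (x, b)) := by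
    rw [sum_comm, ← sum_neg_distrib]
    refine sum_congr rfl fun x _ => ?_
    rw [← sum_mul]; simp [negMulLog]
  rw [h1, h2, h3]; ring

omit [DecidableEq B] in
/-- Each conditional term is `β_b · D(J(·,b)/β_b ‖ P)` and is nonnegative; **the total variation of
a conditional law from the marginal is controlled by the mutual information**: for `β_b > 0`,
`2·β_b·TV(J(·,b)/β_b, P)² ≤ H(P) + H(β) − H(J)` (Pinsker under absolute continuity, `J(·,b) ≤ P`).
[cite: PolyanskiyWu2024, Thm 3.2 (a), Thm 7.10] -/
theorem two_mul_mul_tvDist_cond_sq_le {J : X × B → ℝ} (hJ : ∀ z, 0 ≤ J z) (hJ1 : ∑ z, J z = 1)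
    (b : B) (hb : 0 < ∑ x, J (x, b)) :
    2 * (∑ x, J (x, b)) *
        tvDist (fun x => J (x, b) / ∑ x', J (x', b)) (fun x => ∑ b', J (x, b')) ^ 2
      ≤ (∑ x, negMulLog (∑ b, J (x, b))) + (∑ b, negMulLog (∑ x, J (x, b)))
          - ∑ z, negMulLog (J z) := by
  rw [← sum_mul_log_cond_eq hJ]
  -- the marginal `P` and its properties
  have hP0 : ∀ x, 0 ≤ ∑ b', J (x, b') := fun x => sum_nonneg fun b' _ => hJ (x, b')
  have hP1 : ∑ x, ∑ b', J (x, b') = 1 := by rw [← Fintype.sum_prod_type]; exact hJ1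
  have hle : ∀ x b', J (x, b') ≤ ∑ b'', J (x, b'') :=
    fun x b' => single_le_sum (f := fun b'' => J (x, b'')) (fun b'' _ => hJ (x, b'')) (mem_univ b')
  -- the `b'`-term equals `β_{b'} · KL(cond ‖ P)` and is ≥ `2 β_{b'} TV²` (hence ≥ 0)
  have hterm : ∀ b', 0 < ∑ x, J (x, b') →
      2 * (∑ x, J (x, b')) *
          tvDist (fun x => J (x, b') / ∑ x', J (x', b')) (fun x => ∑ b'', J (x, b'')) ^ 2
        ≤ ∑ x, J (x, b') * Real.log (J (x, b') / ((∑ x', J (x', b')) * ∑ b'', J (x, b''))) := by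
    intro b' hb'
    have hpin := two_mul_tvDist_sq_le_kl_of_ac (P := fun x => J (x, b') / ∑ x', J (x', b'))
      (Q := fun x => ∑ b'', J (x, b'')) (fun x => div_nonneg (hJ (x, b')) hb'.le) hP0
      (fun x hx => by
        have : J (x, b') = 0 := le_antisymm (by rw [← hx]; exact hle x b') (hJ (x, b'))
        rw [this, zero_div])
      (by rw [← sum_div, div_self hb'.ne']) hP1
    have hid : ∑ x, J (x, b') * Real.log (J (x, b') / ((∑ x', J (x', b')) * ∑ b'', J (x, b'')))
        = (∑ x, J (x, b')) * ∑ x, (J (x, b') / ∑ x', J (x', b')) *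
            Real.log ((J (x, b') / ∑ x', J (x', b')) / ∑ b'', J (x, b'')) := by
      rw [mul_sum]
      refine sum_congr rfl fun x _ => ?_
      rw [div_div, ← mul_assoc, mul_div_cancel₀ _ hb'.ne']
    rw [hid]
    have := mul_le_mul_of_nonneg_left hpin hb'.le
    linarith
  have hnonneg : ∀ b', 0 ≤ ∑ x, J (x, b') *
      Real.log (J (x, b') / ((∑ x', J (x', b')) * ∑ b'', J (x, b''))) := by
    intro b'
    by_cases hb' : ∑ x, J (x, b') = 0
    · have hz : ∀ x, J (x, b') = 0 :=
        fun x => (sum_eq_zero_iff_of_nonneg (fun x _ => hJ (x, b'))).mp hb' x (mem_univ x)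
      simp [hz]
    · have hpos : 0 < ∑ x, J (x, b') := lt_of_le_of_ne (sum_nonneg fun x _ => hJ (x, b')) (Ne.symm hb')
      exact le_trans (by positivity) (hterm b' hpos)
  exact (hterm b hb).trans (single_le_sum (fun b' _ => hnonneg b') (mem_univ b))

end MutualInfo

/-! ### 5. The entropy loss under a map is concave; conditional data processing -/

section DataProcessing

variable {W : Type*} [Fintype W] {B : Type*} [Fintype B]

omit [Fintype X] [DecidableEq X] [Fintype W] in
/-- The fibre inequality behind the concavity of the entropy loss: on a finite set `F`, with masses
`m_b = Σ_F ν_b` and `M = Σ_F Σ_b β_b ν_b`,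
`Σ_b β_b · m_b · H(ν_b|_F/m_b) ≤ M · H((Σ_b β_b ν_b)|_F / M)`. [cite: PolyanskiyWu2024, Thm 1.4 (d)] -/
private theorem fiber_loss_le (F : Finset W) (β : B → ℝ) (hβ : ∀ b, 0 ≤ β b) (ν : B → W → ℝ)
    (hν : ∀ b w, 0 ≤ ν b w) :
    ∑ b, β b * ((∑ w ∈ F, ν b w) * ∑ w ∈ F, negMulLog (ν b w / ∑ w' ∈ F, ν b w'))
      ≤ (∑ w ∈ F, ∑ b, β b * ν b w) *
          ∑ w ∈ F, negMulLog ((∑ b, β b * ν b w) / ∑ w' ∈ F, ∑ b, β b * ν b w') := by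
  set m : B → ℝ := fun b => ∑ w ∈ F, ν b w with hm
  have hm0 : ∀ b, 0 ≤ m b := fun b => sum_nonneg fun w _ => hν b w
  set M := ∑ w ∈ F, ∑ b, β b * ν b w with hMdef
  have hM : M = ∑ b, β b * m b := by
    rw [hMdef, sum_comm]; simp_rw [hm, mul_sum]
  have hM0 : 0 ≤ M := by rw [hM]; exact sum_nonneg fun b _ => mul_nonneg (hβ b) (hm0 b)
  by_cases hMz : M = 0
  · have hz : ∀ b, β b * m b = 0 := by
      have := (sum_eq_zero_iff_of_nonneg (fun b _ => mul_nonneg (hβ b) (hm0 b))).mp (hM ▸ hMz)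
      exact fun b => this b (mem_univ b)
    rw [hMz, zero_mul]
    refine le_of_eq (sum_eq_zero fun b _ => ?_)
    rw [← mul_assoc, show β b * m b = 0 from hz b, zero_mul]
  · have hconc := sum_mul_sum_negMulLog_le (X := W) F (fun b => β b * m b / M)
      (fun b => div_nonneg (mul_nonneg (hβ b) (hm0 b)) hM0)
      (by rw [← sum_div, ← hM, div_self hMz])
      (fun b w => ν b w / m b) (fun b w => div_nonneg (hν b w) (hm0 b))
    have hmixF : ∀ w ∈ F, ∑ b, β b * m b / M * (ν b w / m b) = (∑ b, β b * ν b w) / M := by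
      intro w hw
      rw [sum_div]
      refine sum_congr rfl fun b _ => ?_
      by_cases hmb : m b = 0
      · have : ν b w = 0 := (sum_eq_zero_iff_of_nonneg (fun w _ => hν b w)).mp hmb w hw
        rw [hmb, this]; simp
      · field_simp
    have hR' : ∑ w ∈ F, negMulLog (∑ b, β b * m b / M * (ν b w / m b))
        = ∑ w ∈ F, negMulLog ((∑ b, β b * ν b w) / M) :=
      sum_congr rfl fun w hw => by rw [hmixF w hw]
    rw [hR'] at hconc
    have hscale := mul_le_mul_of_nonneg_left hconc hM0
    simp only [hm] at hscale
    refine le_trans (le_of_eq ?_) hscale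
    rw [mul_sum]
    refine sum_congr rfl fun b _ => ?_
    have e : ∀ a s t : ℝ, M * (a * s / M * t) = a * (s * t) := fun a s t => by field_simp
    rw [e]

/-- **Concavity of the entropy loss under a deterministic map**: for `f : W → X`, weights `β ≥ 0`
and laws `ν_b ≥ 0`, with `loss(ν) := H(ν) − H(f_*ν) = Σ_x (f_*ν)(x)·H(ν|_x/(f_*ν)(x))`:
`Σ_b β_b loss(ν_b) ≤ loss(Σ_b β_b ν_b)` (`H(W | f(W))` is concave in the law of `W`).
[cite: PolyanskiyWu2024, Thm 3.2 (d) (proof via DPI)] -/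
theorem sum_negMulLog_loss_concave (f : W → X) (β : B → ℝ) (hβ : ∀ b, 0 ≤ β b)
    (ν : B → W → ℝ) (hν : ∀ b w, 0 ≤ ν b w) :
    ∑ b, β b * ((∑ w, negMulLog (ν b w))
        - ∑ x, negMulLog (∑ w ∈ univ.filter (fun w => f w = x), ν b w))
      ≤ (∑ w, negMulLog (∑ b, β b * ν b w))
        - ∑ x, negMulLog (∑ w ∈ univ.filter (fun w => f w = x), ∑ b, β b * ν b w) := by
  have hmix0 : ∀ w, 0 ≤ ∑ b, β b * ν b w := fun w => sum_nonneg fun b _ => mul_nonneg (hβ b) (hν b w)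
  have hL : ∀ b, (∑ w, negMulLog (ν b w))
      - ∑ x, negMulLog (∑ w ∈ univ.filter (fun w => f w = x), ν b w)
      = ∑ x, (∑ w ∈ univ.filter (fun w => f w = x), ν b w) *
          ∑ w ∈ univ.filter (fun w => f w = x),
            negMulLog (ν b w / ∑ w' ∈ univ.filter (fun w' => f w' = x), ν b w') := by
    intro b; rw [sum_negMulLog_eq_fiber_chain f (hν b)]; ring
  have hR : (∑ w, negMulLog (∑ b, β b * ν b w))
      - ∑ x, negMulLog (∑ w ∈ univ.filter (fun w => f w = x), ∑ b, β b * ν b w)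
      = ∑ x, (∑ w ∈ univ.filter (fun w => f w = x), ∑ b, β b * ν b w) *
          ∑ w ∈ univ.filter (fun w => f w = x),
            negMulLog ((∑ b, β b * ν b w) /
              ∑ w' ∈ univ.filter (fun w' => f w' = x), ∑ b, β b * ν b w') := by
    rw [sum_negMulLog_eq_fiber_chain f hmix0]; ring
  rw [sum_congr rfl fun b (_ : b ∈ univ) => by rw [hL b], hR]
  calc ∑ b, β b * ∑ x, (∑ w ∈ univ.filter (fun w => f w = x), ν b w) *
          ∑ w ∈ univ.filter (fun w => f w = x),
            negMulLog (ν b w / ∑ w' ∈ univ.filter (fun w' => f w' = x), ν b w')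
      = ∑ x, ∑ b, β b * ((∑ w ∈ univ.filter (fun w => f w = x), ν b w) *
          ∑ w ∈ univ.filter (fun w => f w = x),
            negMulLog (ν b w / ∑ w' ∈ univ.filter (fun w' => f w' = x), ν b w')) := by
        simp_rw [mul_sum]; rw [sum_comm]
    _ ≤ _ := sum_le_sum fun x _ => fiber_loss_le _ β hβ ν hν

/-- **Conditional data processing** (`H(B | W) ≤ H(B | f(W))`, equivalently
`I(B; f(W)) ≤ I(B; W)`): for a joint law `R ≥ 0` on `W × B` and `f : W → X`, with the pushed
joint law `J(x,b) = Σ_{w : f w = x} R(w,b)`: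
`H(R) − H(R_W) ≤ H(J) − H(J_X)`, where `R_W(w) = Σ_b R(w,b)`, `J_X(x) = Σ_b J(x,b)`.
[cite: PolyanskiyWu2024, Thm 3.2 (d)] -/
theorem condEntropy_dataProcessing (f : W → X) {R : W × B → ℝ} (hR : ∀ z, 0 ≤ R z) :
    (∑ z, negMulLog (R z)) - ∑ w, negMulLog (∑ b, R (w, b))
      ≤ (∑ xb : X × B, negMulLog (∑ w ∈ univ.filter (fun w => f w = xb.1), R (w, xb.2)))
        - ∑ x, negMulLog (∑ b, ∑ w ∈ univ.filter (fun w => f w = x), R (w, b)) := by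
  -- conditional laws given `b`: `ν_b(w) = R(w,b)/β_b`, weights `β_b`
  set β : B → ℝ := fun b => ∑ w, R (w, b) with hβdef
  have hβ0 : ∀ b, 0 ≤ β b := fun b => sum_nonneg fun w _ => hR (w, b)
  set ν : B → W → ℝ := fun b w => R (w, b) / β b with hνdef
  have hν0 : ∀ b w, 0 ≤ ν b w := fun b w => div_nonneg (hR (w, b)) (hβ0 b)
  have hβν : ∀ b w, β b * ν b w = R (w, b) := by
    intro b w
    by_cases hb : β b = 0
    · have : R (w, b) = 0 := (sum_eq_zero_iff_of_nonneg (fun w _ => hR (w, b))).mp hb w (mem_univ w)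
      simp [hνdef, hb, this]
    · simp only [hνdef]; exact mul_div_cancel₀ _ hb
  have hconc := sum_negMulLog_loss_concave (X := X) f β hβ0 ν hν0
  -- identify the four entropies
  -- (i) mixture = `R_W`
  have hmix : ∀ w, ∑ b, β b * ν b w = ∑ b, R (w, b) := fun w => sum_congr rfl fun b _ => hβν b w
  simp_rw [hmix] at hconc
  -- (ii) `Σ_b β_b H(ν_b) = H(R) − H(β)` and `Σ_b β_b H(f_*ν_b) = H(J) − H(β)` (chain rules on `B`)
  have hchainR : ∑ z, negMulLog (R z) = ∑ b, negMulLog (β b) + ∑ b, β b * ∑ w, negMulLog (ν b w) := by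
    rw [sum_negMulLog_joint_eq_chain hR]
  have hJ0 : ∀ xb : X × B, 0 ≤ ∑ w ∈ univ.filter (fun w => f w = xb.1), R (w, xb.2) :=
    fun xb => sum_nonneg fun w _ => hR (w, xb.2)
  have hβJ : ∀ b, ∑ x, ∑ w ∈ univ.filter (fun w => f w = x), R (w, b) = β b := by
    intro b
    rw [Finset.sum_fiberwise_of_maps_to (g := f) (fun w _ => mem_univ (f w))]
  have hchainJ : ∑ xb : X × B, negMulLog (∑ w ∈ univ.filter (fun w => f w = xb.1), R (w, xb.2))
      = ∑ b, negMulLog (β b) + ∑ b, β b *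
          ∑ x, negMulLog (∑ w ∈ univ.filter (fun w => f w = x), ν b w) := by
    rw [sum_negMulLog_joint_eq_chain (J := fun xb : X × B =>
      ∑ w ∈ univ.filter (fun w => f w = xb.1), R (w, xb.2)) hJ0]
    simp only
    simp_rw [hβJ]
    congr 1
    refine sum_congr rfl fun b _ => ?_
    by_cases hb : β b = 0
    · rw [hb, zero_mul, zero_mul]
    · congr 1
      refine sum_congr rfl fun x _ => ?_
      congr 1
      rw [sum_div]
  -- (iii) `J_X = f_* R_W`
  have hJX : ∀ x, ∑ b, ∑ w ∈ univ.filter (fun w => f w = x), R (w, b)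
      = ∑ w ∈ univ.filter (fun w => f w = x), ∑ b, R (w, b) := fun x => sum_comm
  simp_rw [hJX]
  rw [hchainR, hchainJ]
  have e : ∑ b, β b * ((∑ w, negMulLog (ν b w))
      - ∑ x, negMulLog (∑ w ∈ univ.filter (fun w => f w = x), ν b w))
      = ∑ b, β b * ∑ w, negMulLog (ν b w)
        - ∑ b, β b * ∑ x, negMulLog (∑ w ∈ univ.filter (fun w => f w = x), ν b w) := by
    rw [← sum_sub_distrib]; exact sum_congr rfl fun b _ => by ring
  rw [e] at hconc
  linarith

end DataProcessing

end Literature.Probability.Entropy
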